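import Mathlib.MeasureTheory.Measure.MeasuredSets
import Summits.Ventures.PercRepro0.Invariance
import Summits.Ventures.PercRepro0.Independence

/-!
# F3 in Lean: translation-invariant events are trivial (ergodicity of `P_p`), seat p6

Kernel-checked companion of `proofs/UNIQUENESS-p6-v1.md` §1.0 (B2) and §1.3 (Lemma 1.3), on the cell's
definitions module `Defs.lean` (p5) with its F2 (`Invariance.lean`) and F5 (`Independence.lean`) twins:

* (B2) `exists_finDet_symmDiff_lt`: every measurable event of `setBer(u, p)` is approximated in measure by
  an event determined by finitely many coordinates (Mathlib's
  `exists_measure_symmDiff_lt_of_generateFrom_isSetRing` applied to the ring `finDet ι` of finitely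
  determined events, which generates the product σ-algebra: `generateFrom_finDet`);
* `measurableSet_sigmaOn_preimage_relabel`: relabelling along `g` carries `F_E` to `F_{g '' E}`;
* `exists_shift_disjoint`: for `d ≥ 1` and a finite bond set `E` there is a translation `z` with
  `E ∩ (E + z) = ∅` (translate by `2K + 1` in every coordinate, `K` a bound on the coordinates of `E`);
* Lemma 1.3 = `P_zero_or_one_of_shift_invariant`: a measurable event `A` with `T_z⁻¹ A = A` for every
  `z ∈ ℤ^d` has `P_p(A) ∈ {0, 1}` — the paper's proof: `|P(A) − P(B)²| < 2ε` with `B` finitely determined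
  and `B' = T_z⁻¹ B` independent of `B` by F5, `P(B') = P(B)` by F2;
* application (Corollary 1.4 in the form used by the uniqueness proof): the events `atLeastInf d k`
  = «at least `k` pairwise distinct infinite open clusters» are measurable and translation invariant, hence
  trivial (`P_atLeastInf_zero_or_one`), and `atMostOneInfCluster d = (atLeastInf d 2)ᶜ`.
-/

namespace Summit.Ventures.PercRepro0.Ergodic

open MeasureTheory ProbabilityTheory unitInterval Set
open scoped ENNReal symmDiff
open Summit.Ventures.PercRepro0.Defs

/-! ## (B2) Approximation by finitely determined events (general index type) -/

section FinDet

variable {ι : Type*}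

/-- The events determined by finitely many coordinates: `A ∈ F_E` for some finite `E`. -/
def finDet (ι : Type*) : Set (Set (Set ι)) :=
  {A | ∃ E : Finset ι, MeasurableSet[sigmaOn (E : Set ι)] A}

/-- A finitely determined event is measurable. -/
theorem measurableSet_of_mem_finDet {A : Set (Set ι)} (hA : A ∈ finDet ι) : MeasurableSet A := by
  obtain ⟨E, hE⟩ := hA
  exact sigmaOn_le (E : Set ι) _ hE

/-- The coordinate event `{ω : e ∈ ω}` is finitely determined. -/
theorem mem_finDet_of_coord (e : ι) : {ω : Set ι | e ∈ ω} ∈ finDet ι :=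
  ⟨{e}, measurableSet_sigmaOn_mem (by simp)⟩

/-- `univ` is finitely determined. -/
theorem univ_mem_finDet : (Set.univ : Set (Set ι)) ∈ finDet ι :=
  ⟨∅, @MeasurableSet.univ _ (sigmaOn _)⟩

/-- The finitely determined events form a ring of sets. -/
theorem isSetRing_finDet : IsSetRing (finDet ι) := by
  classical
  refine ⟨⟨∅, @MeasurableSet.empty _ (sigmaOn _)⟩, ?_, ?_⟩
  · rintro s t ⟨E₁, h₁⟩ ⟨E₂, h₂⟩
    refine ⟨E₁ ∪ E₂, MeasurableSet.union (m := sigmaOn _) ?_ ?_⟩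
    · exact sigmaOn_mono (by simp) _ h₁
    · exact sigmaOn_mono (by simp) _ h₂
  · rintro s t ⟨E₁, h₁⟩ ⟨E₂, h₂⟩
    refine ⟨E₁ ∪ E₂, MeasurableSet.diff (m := sigmaOn _) ?_ ?_⟩
    · exact sigmaOn_mono (by simp) _ h₁
    · exact sigmaOn_mono (by simp) _ h₂

/-- The finitely determined events generate the product σ-algebra of `Set ι`. -/
theorem generateFrom_finDet :
    MeasurableSpace.generateFrom (finDet ι) = (Set.instMeasurableSpace : MeasurableSpace (Set ι)) := by
  refine le_antisymm ?_ ?_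
  · refine MeasurableSpace.generateFrom_le ?_
    intro A hA
    exact (measurableSet_of_mem_finDet hA : MeasurableSet[Set.instMeasurableSpace] A)
  · -- the product σ-algebra is generated by the coordinates, each of which is finitely determined
    show (MeasurableSpace.pi : MeasurableSpace (ι → Prop)) ≤ MeasurableSpace.generateFrom (finDet ι)
    refine iSup_le fun e => ?_
    refine measurable_iff_comap_le.1
      (@measurable_to_prop (ι → Prop) (MeasurableSpace.generateFrom (finDet ι)) (fun ω => ω e) ?_)
    have : (fun ω : ι → Prop => ω e) ⁻¹' {True} = {ω : Set ι | e ∈ ω} := by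
      ext ω
      simp only [Set.mem_preimage, Set.mem_singleton_iff, eq_iff_iff, iff_true]
      exact Iff.rfl
    rw [this]
    exact MeasurableSpace.measurableSet_generateFrom (mem_finDet_of_coord e)

/-- (B2): every measurable event is approximated in `setBer(u, p)`-measure by a finitely determined event. -/
theorem exists_finDet_symmDiff_lt (u : Set ι) (p : I) {A : Set (Set ι)} (hA : MeasurableSet A)
    {ε : ℝ≥0∞} (hε : 0 < ε) :
    ∃ E : Finset ι, ∃ B : Set (Set ι), MeasurableSet[sigmaOn (E : Set ι)] B ∧
      setBernoulli u p (B ∆ A) < ε := by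
  obtain ⟨B, ⟨E, hE⟩, hB⟩ := exists_measure_symmDiff_lt_of_generateFrom_isSetRing
    (μ := setBernoulli u p) isSetRing_finDet
    ⟨{Set.univ}, Set.countable_singleton _, by simpa using univ_mem_finDet, by simp⟩
    generateFrom_finDet.symm hA hε
  exact ⟨E, B, hE, hB⟩

/-- Relabelling along a bijection `g` carries `F_E`-measurable events to `F_{g '' E}`-measurable ones. -/
theorem measurableSet_sigmaOn_preimage_relabel (g : ι ≃ ι) {E : Set ι} {B : Set (Set ι)}
    (hB : MeasurableSet[sigmaOn E] B) : MeasurableSet[sigmaOn (g '' E)] (relabel g ⁻¹' B) := by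
  have hle : MeasurableSpace.comap (relabel g) (sigmaOn E) ≤ sigmaOn (g '' E) := by
    rw [sigmaOn, MeasurableSpace.comap_iSup]
    refine iSup_le fun e => ?_
    rw [MeasurableSpace.comap_iSup]
    refine iSup_le fun he => ?_
    rw [coordSigma, MeasurableSpace.comap_comp]
    exact le_iSup₂ (f := fun e (_ : e ∈ g '' E) => coordSigma e) (g e) (Set.mem_image_of_mem g he)
  exact hle _ (MeasurableSpace.measurableSet_comap.2 ⟨B, hB, rfl⟩)

end FinDet

/-! ## A translation separating a finite bond set from itself -/

variable {d : ℕ}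

/-- The larger of the moduli of the `i`-th coordinates of the two endpoints of a bond, as a natural number. -/
def coordBound (i : Fin d) (e : Sym2 (Vertex d)) : ℕ :=
  Sym2.lift ⟨fun x y => max (|x i|).toNat (|y i|).toNat, fun _ _ => max_comm _ _⟩ e

/-- Every endpoint `x` of `e` has `|x i| ≤ coordBound i e`. -/
theorem abs_le_coordBound (i : Fin d) (e : Sym2 (Vertex d)) {x : Vertex d} (hx : x ∈ e) :
    |x i| ≤ (coordBound i e : ℤ) := by
  induction e using Sym2.ind with
  | h a b =>
    rw [Sym2.mem_iff] at hx
    rcases hx with rfl | rfl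
    · exact Int.toNat_le.1 (le_max_left _ _)
    · exact Int.toNat_le.1 (le_max_right _ _)

/-- For `d ≥ 1` and a finite bond set `E` there is a translation `z` with `E ∩ (E + z) = ∅`. -/
theorem exists_shift_disjoint (hd : 1 ≤ d) (E : Finset (Sym2 (Vertex d))) :
    ∃ z : Vertex d, Disjoint (E : Set (Sym2 (Vertex d))) (bondShift z '' (E : Set (Sym2 (Vertex d)))) := by
  let i : Fin d := ⟨0, hd⟩
  let K : ℕ := E.sup (coordBound i)
  let z : Vertex d := fun _ => (2 * K + 1 : ℤ)
  refine ⟨z, ?_⟩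
  rw [Set.disjoint_left]
  rintro e' he' ⟨e, he, rfl⟩
  -- a vertex of `e`, shifted, lies on `bondShift z e = e' ∈ E`, but its `i`-th coordinate is too large
  obtain ⟨x, hx⟩ : ∃ x, x ∈ e := by
    induction e using Sym2.ind with
    | h a b => exact ⟨a, by simp⟩
  have hxK : |x i| ≤ (K : ℤ) := by
    refine (abs_le_coordBound i e hx).trans ?_
    exact_mod_cast Finset.le_sup (f := coordBound i) he
  have hmem : x + z ∈ bondShift z e := by
    show x + z ∈ Sym2.map (· + z) e
    exact Sym2.mem_map.2 ⟨x, hx, rfl⟩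
  have hK' : |(x + z) i| ≤ (K : ℤ) := by
    refine (abs_le_coordBound i _ hmem).trans ?_
    exact_mod_cast Finset.le_sup (f := coordBound i) he'
  have h1 : (x + z) i = x i + (2 * K + 1) := rfl
  rw [h1] at hK'
  have h2 := (abs_le.1 hxK).1
  have h3 := (abs_le.1 hK').2
  omega

/-! ## Lemma 1.3: translation-invariant events are trivial -/

/-- `|μ S − μ T| ≤ μ (S ∆ T)` (real values, finite measure). -/
theorem abs_toReal_sub_le_symmDiff {α : Type*} [MeasurableSpace α] (μ : Measure α)
    [IsFiniteMeasure μ] (S T : Set α) :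
    |(μ S).toReal - (μ T).toReal| ≤ (μ (S ∆ T)).toReal := by
  have key : ∀ S T : Set α, (μ S).toReal ≤ (μ T).toReal + (μ (S ∆ T)).toReal := by
    intro S T
    have h1 : μ S ≤ μ T + μ (S ∆ T) := by
      calc μ S ≤ μ (T ∪ S ∆ T) := measure_mono fun x hx => by
              by_cases hT : x ∈ T
              · exact Or.inl hT
              · exact Or.inr (Or.inl ⟨hx, hT⟩)
        _ ≤ μ T + μ (S ∆ T) := measure_union_le _ _
    have h2 := ENNReal.toReal_mono (by finiteness) h1
    rwa [ENNReal.toReal_add (measure_ne_top _ _) (measure_ne_top _ _)] at h2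
  rw [abs_sub_le_iff]
  constructor
  · linarith [key S T]
  · have := key T S
    rw [symmDiff_comm] at this
    linarith

/-- Lemma 1.3 (F3): a measurable event invariant under every translation has probability `0` or `1`
(`d ≥ 1`). -/
theorem P_zero_or_one_of_shift_invariant (hd : 1 ≤ d) (p : I) {A : Set (Config d)}
    (hA : MeasurableSet A) (hinv : ∀ z : Vertex d, shiftConfig z ⁻¹' A = A) :
    P d p A = 0 ∨ P d p A = 1 := by
  set a : ℝ := (P d p A).toReal with ha
  -- Step 1: `|a − a²| < 4ε` for every `ε > 0`
  have hsq : ∀ ε : ℝ, 0 < ε → |a - a * a| < 4 * ε := by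
    intro ε hε
    obtain ⟨E, B, hBE, hBA⟩ := exists_finDet_symmDiff_lt (bonds d) p hA
      (ENNReal.ofReal_pos.2 hε)
    obtain ⟨z, hz⟩ := exists_shift_disjoint hd E
    have hBm : MeasurableSet B := sigmaOn_le _ _ hBE
    set B' : Set (Config d) := shiftConfig z ⁻¹' B with hB'
    have hB'E : MeasurableSet[sigmaOn (bondShift z '' (E : Set (Sym2 (Vertex d))))] B' :=
      measurableSet_sigmaOn_preimage_relabel (bondShift z) hBE
    have hB'm : MeasurableSet B' := hBm.preimage (measurable_shiftConfig z)
    -- the three measure facts of the paper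
    have hBA_real : (P d p (B ∆ A)).toReal < ε := ENNReal.toReal_lt_of_lt_ofReal hBA
    have hB'A : P d p (B' ∆ A) = P d p (B ∆ A) := by
      have : B' ∆ A = shiftConfig z ⁻¹' (B ∆ A) := by
        rw [Set.preimage_symmDiff, hinv z]
      rw [this, P_shiftConfig_preimage z p (hBm.symmDiff hA)]
    have hB'B : P d p B' = P d p B := P_shiftConfig_preimage z p hBm
    have hind : P d p (B ∩ B') = P d p B * P d p B' :=
      P_inter_eq_mul_of_disjoint p hz hBE hB'E
    -- real numbers
    set b : ℝ := (P d p B).toReal with hb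
    have hb0 : 0 ≤ b := ENNReal.toReal_nonneg
    have hb1 : b ≤ 1 := by
      rw [hb]
      exact ENNReal.toReal_le_of_le_ofReal zero_le_one (by simpa using (prob_le_one : P d p B ≤ 1))
    have ha0 : 0 ≤ a := ENNReal.toReal_nonneg
    have ha1 : a ≤ 1 := by
      rw [ha]
      exact ENNReal.toReal_le_of_le_ofReal zero_le_one (by simpa using (prob_le_one : P d p A ≤ 1))
    have hBB' : (P d p (B ∩ B')).toReal = b * b := by
      rw [hind, ENNReal.toReal_mul, hB'B]
    -- `|a − b| < ε`
    have h1 : |a - b| < ε := by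
      have := abs_toReal_sub_le_symmDiff (P d p) A B
      rw [symmDiff_comm] at this
      linarith
    -- `|a − b²| < 2ε`: `A ∆ (B ∩ B') ⊆ (B ∆ A) ∪ (B' ∆ A)`
    have h2 : |a - b * b| < 2 * ε := by
      have hsub : A ∆ (B ∩ B') ⊆ (B ∆ A) ∪ (B' ∆ A) := by
        intro x hx
        rcases hx with ⟨hxA, hxBB'⟩ | ⟨⟨hxB, hxB'⟩, hxA⟩
        · by_cases hxB : x ∈ B
          · have hxB' : x ∉ B' := fun h => hxBB' ⟨hxB, h⟩
            exact Or.inr (Or.inr ⟨hxA, hxB'⟩)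
          · exact Or.inl (Or.inr ⟨hxA, hxB⟩)
        · exact Or.inl (Or.inl ⟨hxB, hxA⟩)
      have hmeas : (P d p (A ∆ (B ∩ B'))).toReal ≤ (P d p (B ∆ A)).toReal + (P d p (B' ∆ A)).toReal := by
        have := (measure_mono hsub).trans (measure_union_le (μ := P d p) (B ∆ A) (B' ∆ A))
        have := ENNReal.toReal_mono (by finiteness) this
        rwa [ENNReal.toReal_add (measure_ne_top _ _) (measure_ne_top _ _)] at this
      have := abs_toReal_sub_le_symmDiff (P d p) A (B ∩ B')
      rw [hBB'] at this
      rw [hB'A] at hmeas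
      linarith
    -- `|a² − b²| ≤ 2 |a − b|`
    have h3 : |a * a - b * b| ≤ 2 * |a - b| := by
      have : a * a - b * b = (a - b) * (a + b) := by ring
      rw [this, abs_mul]
      have hab : |a + b| ≤ 2 := by
        rw [abs_le]; constructor <;> linarith
      calc |a - b| * |a + b| ≤ |a - b| * 2 := by gcongr
        _ = 2 * |a - b| := by ring
    calc |a - a * a| = |(a - b * b) - (a * a - b * b)| := by ring_nf
      _ ≤ |a - b * b| + |a * a - b * b| := abs_sub _ _
      _ < 2 * ε + 2 * ε := by linarith
      _ = 4 * ε := by ring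
  -- Step 2: hence `a = a²`, so `a ∈ {0, 1}`
  have haa : a = a * a := by
    by_contra hne
    have hpos : 0 < |a - a * a| := abs_pos.2 (sub_ne_zero.2 hne)
    have := hsq (|a - a * a| / 4) (by positivity)
    linarith
  have hsplit : a = 0 ∨ a = 1 := by
    have : a * (a - 1) = 0 := by ring_nf; linarith
    rcases mul_eq_zero.1 this with h | h
    · exact Or.inl h
    · exact Or.inr (by linarith)
  rcases hsplit with h | h
  · left
    rw [ha, ENNReal.toReal_eq_zero_iff] at h
    exact h.resolve_right (measure_ne_top _ _)
  · right
    rw [ha, ENNReal.toReal_eq_one_iff] at h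
    exact h

/-! ## Application: the events «at least `k` distinct infinite open clusters» are trivial -/

/-- The event «there are at least `k` pairwise distinct infinite open clusters»: `k` vertices in infinite
clusters, pairwise not connected. -/
def atLeastInf (d k : ℕ) : Set (Config d) :=
  {ω | ∃ x : Fin k → Vertex d, (∀ i, ConnInf d ω (x i)) ∧ ∀ i j, i ≠ j → ¬ Conn d ω (x i) (x j)}

/-- `atLeastInf d k` is measurable (a countable union of finite Boolean combinations of F1 events). -/
theorem measurableSet_atLeastInf (k : ℕ) : MeasurableSet (atLeastInf d k) := by
  have : atLeastInf d k = ⋃ x : Fin k → Vertex d,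
      ((⋂ i, {ω : Config d | ConnInf d ω (x i)}) ∩
        ⋂ i, ⋂ j, ⋂ (_ : i ≠ j), {ω : Config d | Conn d ω (x i) (x j)}ᶜ) := by
    ext ω
    simp only [atLeastInf, Set.mem_setOf_eq, Set.mem_iUnion, Set.mem_inter_iff, Set.mem_iInter,
      Set.mem_compl_iff]
  rw [this]
  refine MeasurableSet.iUnion fun x => MeasurableSet.inter ?_ ?_
  · exact MeasurableSet.iInter fun i => measurableSet_connInf (x i)
  · exact MeasurableSet.iInter fun i => MeasurableSet.iInter fun j => MeasurableSet.iInter fun _ =>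
      (measurableSet_conn (x i) (x j)).compl

/-- `atLeastInf d k` is translation invariant. -/
theorem preimage_shiftConfig_atLeastInf (z : Vertex d) (k : ℕ) :
    shiftConfig z ⁻¹' atLeastInf d k = atLeastInf d k := by
  ext ω
  simp only [Set.mem_preimage, atLeastInf, Set.mem_setOf_eq, connInf_shiftConfig, conn_shiftConfig]
  constructor
  · rintro ⟨x, hx, hxx⟩
    exact ⟨fun i => x i + z, hx, hxx⟩
  · rintro ⟨x, hx, hxx⟩
    refine ⟨fun i => x i - z, fun i => by simpa using hx i, fun i j hij => by simpa using hxx i j hij⟩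

/-- Corollary 1.4 (the form used by the uniqueness proof): for `d ≥ 1`, `P_p(N ≥ k) ∈ {0, 1}`. -/
theorem P_atLeastInf_zero_or_one (hd : 1 ≤ d) (p : I) (k : ℕ) :
    P d p (atLeastInf d k) = 0 ∨ P d p (atLeastInf d k) = 1 :=
  P_zero_or_one_of_shift_invariant hd p (measurableSet_atLeastInf k)
    fun z => preimage_shiftConfig_atLeastInf z k

/-- `{N ≤ 1}` is the complement of `{N ≥ 2}`. -/
theorem atMostOneInfCluster_eq_compl : atMostOneInfCluster d = (atLeastInf d 2)ᶜ := by
  ext ω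
  simp only [atMostOneInfCluster, Set.mem_setOf_eq, Set.mem_compl_iff, atLeastInf, not_exists,
    not_and]
  constructor
  · intro h x hx hxx
    exact hxx 0 1 (by decide) (h _ _ (hx 0) (hx 1))
  · intro h x y hx hy
    by_contra hxy
    refine h ![x, y] (fun i => ?_) (fun i j hij => ?_)
    · fin_cases i <;> assumption
    · fin_cases i <;> fin_cases j
      · exact absurd rfl hij
      · exact hxy
      · exact fun h' => hxy (SimpleGraph.Reachable.symm h')
      · exact absurd rfl hij

end Summit.Ventures.PercRepro0.Ergodic
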